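import Literature.MathematicalPhysics.QuantumLattice.HubbardNNNHoppingClusterLowerBound
import HarnessLib

/-!
# The `2 × 2` Anderson-cluster lower bound for the `t–t'–U` Hubbard model in table form

Topic `MathematicalPhysics/QuantumLattice`, family `hubbard`. The `2 × 2` (plaquette) companion of
`HubbardNNNHoppingClusterLowerBound2x3.lean`: the same thin corollary layer over
`ClusterLowerBound.groundEnergy_hubbardRectTorusTT'_ge_of_openBox_sectors` (Anderson 1951 eq. (2);
Valentí–Stolze–Hirschfeld 1991 §II for the square-lattice Hubbard model), in exactly the shape a
certificate of sector floors is consumed (the kernel-checked exact-diagonalisation certificates of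
`HubbardOpenBoxEDCertificate` produce precisely the hypothesis `σ k ≤ E₀(h_{2×2}, k)`):

* `groundEnergy_hubbardRectTorusTT'_ge_of_boxFloors_2x2` — if `σ k ≤ E₀(h_{2×2}(t₁, t₁', U₁), k)` for
  `k = 0, …, 8` and `m ≤ σ k + μ k` for those `k`, then for every `a, b ≥ 3` and `N ≤ 2ab`,
  `2ab · m - 8 μ N ≤ E₀(hubbardRectTorusTT' a b (4 t₁) (2 t₁') (8 U₁), N)` (cover of the torus by all
  translates of the plaquette, counted with both orientations: every nearest-neighbour bond covered `4`
  times, every diagonal bond `2` times, every site `8` times, `2ab` clusters);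
* `energyDensityTT'_ge_of_boxFloors_2x2` — the thermodynamic-limit form
  `2 m - 8 μ n ≤ e(4 t₁, 2 t₁', 8 U₁; n)` for `0 ≤ n < 2`, `U₁ ≥ 0` (Ruelle 1969 §3.3 limit via
  `ThermodynamicLimit.energyDensityTT'_ge_of_eventually_ge`).

References: Anderson, Phys. Rev. 83 (1951) 1260, eq. (2) [cite: Anderson1951, eq. (2)];
Valentí–Stolze–Hirschfeld, Phys. Rev. B 43 (1991) 13743, §II [cite: ValentiStolzeHirschfeld1991, §II];
Ruelle 1969 §3.3 [cite: Ruelle1969, §3.3]. Everything is proved; no new definitions, no named facts.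
-/

noncomputable section

namespace Literature.MathematicalPhysics.QuantumLattice

open Matrix Finset Filter Topology
open scoped ComplexOrder

namespace ClusterLowerBound

/-- **The `2 × 2` Anderson-cluster lower bound, table form.** If `σ k` is a lower bound on the
`k`-particle ground-state energy of the open plaquette Hamiltonian `h_{2×2}(t₁, t₁', U₁)` for every
`k ≤ 8`, and `m ≤ σ k + μ k` for those `k`, then on every `a × b` torus with `a, b ≥ 3` and for every
`N ≤ 2ab`: `2ab · m - 8 μ N ≤ E₀(hubbardRectTorusTT' a b (4t₁) (2t₁') (8U₁), N)` — Anderson's bound for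
the cover of the torus by all translates of the plaquette (both orientations: `2ab` clusters; every
nearest-neighbour bond covered `4` times, every diagonal bond `2` times, every site `8` times), with the
chemical-potential shift `μ`. [cite: Anderson1951, eq. (2)] [cite: ValentiStolzeHirschfeld1991, §II] -/
theorem groundEnergy_hubbardRectTorusTT'_ge_of_boxFloors_2x2 {σ : ℕ → ℝ} {t₁ t₁' U₁ : ℝ}
    (hF : ∀ k ≤ 8, σ k ≤ groundEnergy (hubbardOpenBoxTT' 2 2 t₁ t₁' U₁) k)
    {a b : ℕ} (ha : 3 ≤ a) (hb : 3 ≤ b) {t t' U : ℝ} (ht : t = 4 * t₁) (ht' : t' = 2 * t₁')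
    (hU : U = 8 * U₁) (μ m : ℝ) (hm : ∀ k ≤ 8, m ≤ σ k + μ * k) {N : ℕ} (hN : N ≤ 2 * (a * b)) :
    2 * ((a : ℝ) * b) * m - 8 * μ * N ≤ groundEnergy (hubbardRectTorusTT' a b t t' U) N := by
  have h2a : 2 ≤ a := le_trans (by norm_num) ha
  have h2b : 2 ≤ b := le_trans (by norm_num) hb
  have key := groundEnergy_hubbardRectTorusTT'_ge_of_openBox_sectors (r := 2) (c := 2) ha hb h2a h2b
    h2a h2b le_rfl le_rfl t t' U μ m
  have e1 : t / (((2 - 1) * 2 + (2 - 1) * 2 : ℕ) : ℝ) = t₁ := by rw [ht]; norm_num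
  have e2 : t' / ((2 * ((2 - 1) * (2 - 1)) : ℕ) : ℝ) = t₁' := by rw [ht']; norm_num
  have e3 : U / ((2 * (2 * 2) : ℕ) : ℝ) = U₁ := by rw [hU]; norm_num
  rw [e1, e2, e3] at key
  have hσ : ∀ k ≤ 2 * (2 * 2), m ≤ groundEnergy (hubbardOpenBoxTT' 2 2 t₁ t₁' U₁) k + μ * k :=
    fun k hk => (hm k hk).trans (by linarith [hF k hk])
  have h := key hσ hσ hN
  push_cast at h
  linarith

open ThermodynamicLimit in
/-- **The `2 × 2` Anderson-cluster lower bound in the thermodynamic limit.** With the same table of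
sector floors and `m ≤ σ k + μ k` (`k ≤ 8`), the ground-state energy density of the `t–t'–U` model at
density `0 ≤ n < 2` (`U₁ ≥ 0`) satisfies `2m - 8 μ n ≤ e(4t₁, 2t₁', 8U₁; n)`: the finite bound on every
`L × L` torus (`L ≥ 3`, `N = N_L(n)`) divided by `L²`, then `L → ∞` (Ruelle 1969 §3.3).
[cite: Anderson1951, eq. (2)] [cite: Ruelle1969, §3.3] -/
theorem energyDensityTT'_ge_of_boxFloors_2x2 {σ : ℕ → ℝ} {t₁ t₁' U₁ : ℝ}
    (hF : ∀ k ≤ 8, σ k ≤ groundEnergy (hubbardOpenBoxTT' 2 2 t₁ t₁' U₁) k)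
    {t t' U : ℝ} (ht : t = 4 * t₁) (ht' : t' = 2 * t₁') (hU : U = 8 * U₁) (hU0 : 0 ≤ U)
    (μ m : ℝ) (hm : ∀ k ≤ 8, m ≤ σ k + μ * k) {n : ℝ} (hn0 : 0 ≤ n) (hn2 : n < 2) :
    2 * m - 8 * μ * n ≤ energyDensityTT' t t' U n := by
  refine energyDensityTT'_ge_of_eventually_ge t t' hU0 hn0 hn2 (c := 2 * m - 8 * μ * n)
    (μ := -(8 * μ)) ?_
  filter_upwards [eventually_ge_atTop 3] with L hL
  have hLpos : (0 : ℝ) < (L : ℝ) ^ 2 := by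
    have : (3 : ℝ) ≤ L := by exact_mod_cast hL
    positivity
  have hN : rectN n L ≤ 2 * (L * L) := rectN_le_two_mul hn0 hn2.le L
  have h := groundEnergy_hubbardRectTorusTT'_ge_of_boxFloors_2x2 hF hL hL ht ht' hU μ m hm hN
  rw [le_div_iff₀ hLpos]
  have e : (2 * m - 8 * μ * n + -(8 * μ) * ((rectN n L : ℝ) / (L : ℝ) ^ 2 - n)) * (L : ℝ) ^ 2 =
      2 * ((L : ℝ) * L) * m - 8 * μ * (rectN n L : ℝ) := by
    field_simp
    ring
  rw [e]
  exact h

open ThermodynamicLimit in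
/-- **Affine density rows from a `2 × 2` floor table.** In the reading of the box-word files: a certified
table `σ` for the plaquette `h_{2×2}(1/4, s/2, U/8)` and one supporting line `(μ, m)` give, at
`(t, t', U) = (1, s, U)`, the row `∀ n ∈ [n₁, n₂], (2m) + (−8μ)·n ≤ e(1, s, U, n)` (`0 ≤ n₁`, `n₂ < 2`).
[cite: Anderson1951, eq. (2)] [cite: Ruelle1969, §3.3] -/
theorem energyDensityTT'_row_of_boxFloors_2x2 {σ : ℕ → ℝ} {s U : ℝ} (hU0 : 0 ≤ U)
    (hF : ∀ k ≤ 8, σ k ≤ groundEnergy (hubbardOpenBoxTT' 2 2 (1 / 4) (s / 2) (U / 8)) k)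
    (μ m : ℝ) (hm : ∀ k ≤ 8, m ≤ σ k + μ * k) {n₁ n₂ : ℝ} (hn₁ : 0 ≤ n₁) (hn₂ : n₂ < 2) :
    ∀ n ∈ Set.Icc n₁ n₂, 2 * m + (-(8 * μ)) * n ≤ energyDensityTT' 1 s U n := by
  intro n hn
  have h := energyDensityTT'_ge_of_boxFloors_2x2 hF (t := 1) (t' := s) (U := U) (by ring) (by ring) (by ring)
    hU0 μ m hm (hn₁.trans hn.1) (lt_of_le_of_lt hn.2 hn₂)
  linarith

end ClusterLowerBound

end Literature.MathematicalPhysics.QuantumLattice
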